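import Mathlib
import HarnessLib
import Summits.AtomisticToContinuum.FouriersLaw.Theses.MatthiessenLadder

/-!
# Birth skeleton — crux `PrefixIncrementBounds` (stmt-AtomisticToContinuum-12776)
# route `MatthiessenLadder` (AtomisticToContinuum / FouriersLaw), line `birth`

The crux (rank 2 of the route, fixed — decl
`Summit.AtomisticToContinuum.FouriersLaw.Theses.MatthiessenLadder.PrefixIncrementBounds`): for
`ω₂, lam, β, γ > 0` and `T > 0` there are `0 < r_min ≤ r_max` and `k₀, N₀` such that for all
`N ≥ N₀`, `k < N` and all response coefficients `D₀` of the prefix cell chain `cellChain (· < k)` and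
`D₁` of `cellChain (· < k+1)` at `(N, T)`: `D₀, D₁ > 0`, `|(N-1)/D₁ - (N-1)/D₀| ≤ r_max`, and
`(N-1)/D₁ - (N-1)/D₀ ≥ r_min` whenever `k₀ ≤ k` and `k + k₀ < N`.

This file is the BIRTH skeleton (BC3) of the crux: the route's own foreseen glued split
(route header, TWO-LAYER PLAN: `PrefixIncrementBounds ⇐ UpperIncrement → LowerIncrement`) with the
positivity of the finite-`N` conductances of the rungs factored out as its own lemma (route header,
NOT DECOMPOSED YET: "positivity of finite-N conductances as a separate lemma (folded into the
cruxes)"). Three registered stubs, each a genuine analytic statement over tree vocabulary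
(`cellChain`, `SiteChain.IsResponseCoeff`), and the kernel-checked composition
`PrefixIncrementBounds_of : PrefixIncrementBounds` (via `of_parts`, the hypotheses form
`<stub₁-sig> → <stub₂-sig> → <stub₃-sig> → <crux body>`, fully proved).

* `stub_positiveConductance` — POSITIVE CONDUCTANCE OF THE RUNGS: `N`-uniformly in the interface
  position `k`, every response coefficient of `cellChain (· < k)` at `N ≥ N₀`, `T` is `> 0`
  (the inhomogeneous analogue of the LANDED `FeketeSeriesLaw.PositiveConductance` for the
  homogeneous chain: Kundu–Dhar–Narayan open-chain Green–Kubo made strict by the tap-energy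
  identity; here the corrector theory must be redone for the mixed-degree prefix chains).
* `stub_upperIncrement` — NO QUARTIC CELL IS A MIRROR (Lipschitz in the support): moving the
  harmonic/anharmonic interface right by one cell changes the bath-to-bath resistance `(N-1)/D` by
  at most `r_max`, uniformly in `(N, k)`, given positive conductances.
* `stub_bulkLowerIncrement` — MATTHIESSEN'S RESISTANCE QUANTUM: deep in the bulk
  (`k₀ ≤ k`, `k + k₀ < N`) the same move raises the resistance by at least `r_min > 0`, uniformly
  in `(N, k)`, given positive conductances (every quartic cell scatters; the hardest stub).

Disproof used: none — `ledger crux ls stmt-AtomisticToContinuum-12776` shows no `Disproof.lean`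
for this crux at registration time (2026-08-17); the refuter's crux-attack (evidence
crux-attack-12776.md) records that the size guard `N₀ ≤ N` is load-bearing (`N = 1` has the
response coefficient `0`), which every stub below keeps.

BC3 probes (planner folder `bc/stub_*_probe.lean`, `lean check` 2026-08-17): for each stub `S`,
`example : S → PrefixIncrementBounds` and `example : S → _root_.FouriersLaw` by
`first | exact? | simpa [S] | (unfold S; simpa) | aesop` FAIL (rc 1, unsolved goals, aesop exhaustive
search failed) — no stub is cheaply the crux or the summit.
-/

namespace Summit.AtomisticToContinuum.FouriersLaw.Cruxes.PrefixIncrementBounds.Birth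

open Literature.MathematicalPhysics.KineticTheory.HeatConduction
open Summit.AtomisticToContinuum.FouriersLaw.Theses.MatthiessenLadder

/-! ## The stubs (the only unproved declarations of this file) -/

/-- **Stub 1 · positiveConductance — POSITIVE CONDUCTANCE OF THE RUNGS.** For `ω₂, lam, β, γ > 0`
and `T > 0` there is `N₀` such that for all `N ≥ N₀`, all interface positions `k` and every
response coefficient `D` of the prefix cell chain `cellChain (· < k)` at `(N, T)`, `0 < D` (`k = 0`:
the harmonic host, `D = (N-1)·fluxCoeff_N > 0`; `k ≥ N`: the conjunct's `pinnedChain`, where this is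
the landed `FeketeSeriesLaw.PositiveConductance` under the proved `NessUnique`). Why plausibly true: heat flows
from hot to cold at first order in `δT` along every rung — the finite-volume Kubo variance
`D = lim Var(Q_t)/(2tT²)` of the inhomogeneous chain is non-degenerate (the time-integrated contact
current is not an `L²`-coboundary), exactly as proved in tree for the homogeneous chain
(`OddSectorIrreversibilityBoundedResponseConvergesStubPositiveConductance`, Kundu–Dhar–Narayan 2009,
Rey-Bellet 2003 Rem. 4.4, Eckmann–Pillet–Rey-Bellet 1999b). Size: M–L (corrector theory and
weak-NESS identification for `SiteChain` prefix profiles with mixed interaction degrees 2 and 4,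
cf. the route's crux `PrefixSteadyStates`). Leans on: `cellChain`, `SiteChain.IsResponseCoeff`,
`cellChain_isResponseCoeff_congr`, `cellChain_const_true`, `NessUnique_holds`. -/
theorem stub_positiveConductance :
    ∀ ω₂ lam β γ : ℝ, 0 < ω₂ → 0 < lam → 0 < β → 0 < γ → ∀ T : ℝ, 0 < T →
    ∃ N₀ : ℕ, ∀ N k : ℕ, N₀ ≤ N → ∀ D : ℝ,
      (cellChain ω₂ lam β γ (fun i => decide (i < k))).IsResponseCoeff N T D → 0 < D := by
  sorry

/-- **Stub 2 · upperIncrement — NO QUARTIC CELL IS A MIRROR (Lipschitz in the support).** For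
`ω₂, lam, β, γ > 0` and `T > 0` there are `r_max` and `N₀` such that for all `N ≥ N₀`, `k < N` and
all POSITIVE response coefficients `D₀` of `cellChain (· < k)` and `D₁` of `cellChain (· < k+1)` at
`(N, T)`, `|(N-1)/D₁ - (N-1)/D₀| ≤ r_max` (uniform in `N` and in the interface position, contacts
included). Why plausibly true: one quartic cell cannot
reflect a positive fraction of ALL the energy flux uniformly in the length — its pinning and bond
potentials are uniformly convex (`U'' ≥ ω₂`, `V'' ≥ 1`), so the local temperature drop it can
sustain at fixed current is bounded (first-order NESS perturbation theory in the support,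
Lefevere–Schenkel 2006; non-reversible Dirichlet/Thomson principles, Landim–Mariani–Seo 2018;
interface-conductance numerics arXiv:1405.3868). Why it might fail: a Lipschitz-in-support bound on
the RESISTANCE near the contacts (Kapitza-type boundary jumps, doi:10.1103/physrevlett.95.104302)
is in no print. Size: L. Leans on: `cellChain`, `SiteChain.IsResponseCoeff`. -/
theorem stub_upperIncrement :
    ∀ ω₂ lam β γ : ℝ, 0 < ω₂ → 0 < lam → 0 < β → 0 < γ → ∀ T : ℝ, 0 < T →
    ∃ rmax : ℝ, ∃ N₀ : ℕ, ∀ N k : ℕ, N₀ ≤ N → k < N → ∀ D₀ D₁ : ℝ,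
      (cellChain ω₂ lam β γ (fun i => decide (i < k))).IsResponseCoeff N T D₀ →
      (cellChain ω₂ lam β γ (fun i => decide (i < k + 1))).IsResponseCoeff N T D₁ →
      0 < D₀ → 0 < D₁ → |((N : ℝ) - 1) / D₁ - ((N : ℝ) - 1) / D₀| ≤ rmax := by
  sorry

/-- **Stub 3 · bulkLowerIncrement — MATTHIESSEN'S RESISTANCE QUANTUM** (HARDEST, the line's
lever: Matthiessen's rule as an inequality). For `ω₂, lam, β, γ > 0` and `T > 0` there are
`r_min > 0` and `k₀, N₀` such that for all `N ≥ N₀`, all BULK interface positions `k` (`k₀ ≤ k`,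
`k + k₀ < N`) and all positive response coefficients `D₀` of `cellChain (· < k)` and `D₁` of
`cellChain (· < k+1)` at `(N, T)`, `r_min ≤ (N-1)/D₁ - (N-1)/D₀` — every quartic cell switched on
deep in the bulk adds at least one resistance quantum, uniformly in `N` and in the position. Why
plausibly true: a quartic cell deep in the bulk sits
behind `k ≥ k₀` anharmonic cells (a diffusive, phonon-mixing lead on the left) and in front of a
ballistic harmonic lead of length `N - k - 1 ≥ k₀`; switching it on adds an inelastic scatterer in
series, whose thermally averaged reflection is bounded below at fixed `T` (series composition of
resistances / Landauer picture for nonlinear junctions: doi:10.1103/physrevb.73.205415,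
doi:10.1103/physrevlett.88.094302; textbook Matthiessen–Kohler additivity, Ziman ch. 9). Why it
might fail (route header): locality may fail coherently — nothing proves the interface increment is
`Θ(1)` uniformly in `(N, k)` at fixed `T` (`r_min` must survive mean free paths `≫ 1` at small
`lam·T`). Size: open-problem. Leans on: `cellChain`, `SiteChain.IsResponseCoeff`; first rung /
probe: the route's crux `SingleImpurity`. -/
theorem stub_bulkLowerIncrement :
    ∀ ω₂ lam β γ : ℝ, 0 < ω₂ → 0 < lam → 0 < β → 0 < γ → ∀ T : ℝ, 0 < T →
    ∃ rmin : ℝ, 0 < rmin ∧ ∃ k₀ N₀ : ℕ, ∀ N k : ℕ, N₀ ≤ N → k₀ ≤ k → k + k₀ < N → ∀ D₀ D₁ : ℝ,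
      (cellChain ω₂ lam β γ (fun i => decide (i < k))).IsResponseCoeff N T D₀ →
      (cellChain ω₂ lam β γ (fun i => decide (i < k + 1))).IsResponseCoeff N T D₁ →
      0 < D₀ → 0 < D₁ → rmin ≤ ((N : ℝ) - 1) / D₁ - ((N : ℝ) - 1) / D₀ := by
  sorry

/-! ## The composition (fully proved) -/

/-- **Composition, hypotheses form** (`<stub₁-sig> → <stub₂-sig> → <stub₃-sig> →` the body of
`PrefixIncrementBounds`; the three hypotheses are VERBATIM the types of `stub_positiveConductance`,
`stub_upperIncrement`, `stub_bulkLowerIncrement`): take `r_min` from the bulk lower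
bound, `r_max := max r_max r_min` (so that `r_min ≤ r_max`), `k₀` from the bulk lower bound and
`N₀ :=` the max of the three thresholds; positivity of `D₀, D₁` comes from the first hypothesis at
`k` and `k + 1` and feeds the other two. (The conclusion is the crux's body written out, so that
`PrefixIncrementBounds_of` below is the only theorem of this file concluding the crux by name.) -/
theorem of_parts
    (hpos : ∀ ω₂ lam β γ : ℝ, 0 < ω₂ → 0 < lam → 0 < β → 0 < γ → ∀ T : ℝ, 0 < T →
      ∃ N₀ : ℕ, ∀ N k : ℕ, N₀ ≤ N → ∀ D : ℝ,
        (cellChain ω₂ lam β γ (fun i => decide (i < k))).IsResponseCoeff N T D → 0 < D)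
    (hup : ∀ ω₂ lam β γ : ℝ, 0 < ω₂ → 0 < lam → 0 < β → 0 < γ → ∀ T : ℝ, 0 < T →
      ∃ rmax : ℝ, ∃ N₀ : ℕ, ∀ N k : ℕ, N₀ ≤ N → k < N → ∀ D₀ D₁ : ℝ,
        (cellChain ω₂ lam β γ (fun i => decide (i < k))).IsResponseCoeff N T D₀ →
        (cellChain ω₂ lam β γ (fun i => decide (i < k + 1))).IsResponseCoeff N T D₁ →
        0 < D₀ → 0 < D₁ → |((N : ℝ) - 1) / D₁ - ((N : ℝ) - 1) / D₀| ≤ rmax)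
    (hlow : ∀ ω₂ lam β γ : ℝ, 0 < ω₂ → 0 < lam → 0 < β → 0 < γ → ∀ T : ℝ, 0 < T →
      ∃ rmin : ℝ, 0 < rmin ∧ ∃ k₀ N₀ : ℕ, ∀ N k : ℕ, N₀ ≤ N → k₀ ≤ k → k + k₀ < N → ∀ D₀ D₁ : ℝ,
        (cellChain ω₂ lam β γ (fun i => decide (i < k))).IsResponseCoeff N T D₀ →
        (cellChain ω₂ lam β γ (fun i => decide (i < k + 1))).IsResponseCoeff N T D₁ →
        0 < D₀ → 0 < D₁ → rmin ≤ ((N : ℝ) - 1) / D₁ - ((N : ℝ) - 1) / D₀) :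
    ∀ ω₂ lam β γ : ℝ, 0 < ω₂ → 0 < lam → 0 < β → 0 < γ → ∀ T : ℝ, 0 < T → ∃ rmin rmax : ℝ,
      0 < rmin ∧ rmin ≤ rmax ∧ ∃ k₀ N₀ : ℕ, ∀ N k : ℕ, N₀ ≤ N → k < N → ∀ D₀ D₁ : ℝ,
        (cellChain ω₂ lam β γ (fun i => decide (i < k))).IsResponseCoeff N T D₀ →
        (cellChain ω₂ lam β γ (fun i => decide (i < k + 1))).IsResponseCoeff N T D₁ →
        0 < D₀ ∧ 0 < D₁ ∧ |((N : ℝ) - 1) / D₁ - ((N : ℝ) - 1) / D₀| ≤ rmax ∧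
          (k₀ ≤ k → k + k₀ < N → rmin ≤ ((N : ℝ) - 1) / D₁ - ((N : ℝ) - 1) / D₀) := by
  intro ω₂ lam β γ hω hl hβ hγ T hT
  obtain ⟨N₁, h₁⟩ := hpos ω₂ lam β γ hω hl hβ hγ T hT
  obtain ⟨rmax, N₂, h₂⟩ := hup ω₂ lam β γ hω hl hβ hγ T hT
  obtain ⟨rmin, hrmin, k₀, N₃, h₃⟩ := hlow ω₂ lam β γ hω hl hβ hγ T hT
  refine ⟨rmin, max rmax rmin, hrmin, le_max_right _ _, k₀, max (max N₁ N₂) N₃, ?_⟩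
  intro N k hN hk D₀ D₁ hD₀ hD₁
  have hN₁ : N₁ ≤ N := le_trans (le_trans (le_max_left _ _) (le_max_left _ _)) hN
  have hN₂ : N₂ ≤ N := le_trans (le_trans (le_max_right _ _) (le_max_left _ _)) hN
  have hN₃ : N₃ ≤ N := le_trans (le_max_right _ _) hN
  have p₀ : 0 < D₀ := h₁ N k hN₁ D₀ hD₀
  have p₁ : 0 < D₁ := h₁ N (k + 1) hN₁ D₁ hD₁
  refine ⟨p₀, p₁, ?_, ?_⟩
  · exact le_trans (h₂ N k hN₂ hk D₀ D₁ hD₀ hD₁ p₀ p₁) (le_max_left _ _)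
  · intro hk₀ hkN
    exact h₃ N k hN₃ hk₀ hkN D₀ D₁ hD₀ hD₁ p₀ p₁

/-- **The skeleton theorem.** The three stubs imply the crux
`MatthiessenLadder.PrefixIncrementBounds`, concluded BY NAME; the only unproved inputs are
`stub_positiveConductance`, `stub_upperIncrement`, `stub_bulkLowerIncrement`. -/
theorem PrefixIncrementBounds_of : PrefixIncrementBounds :=
  of_parts stub_positiveConductance stub_upperIncrement stub_bulkLowerIncrement

end Summit.AtomisticToContinuum.FouriersLaw.Cruxes.PrefixIncrementBounds.Birth
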